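import Literature.Dynamics.Hamiltonian.ChengXue2023.TrivialSquares
import Literature.Probability.Percolation.AnnulusSubcontinuum

/-!
# Grid boxes: a correct form of the "trivial on every cell of a grid ⇒ small connected components" step
# of the barrier-function genericity device (positive counterpart of `TrivialSquares.lean`)

CITATION HEADER (lean-in-tree rule 2026-08-18). Source under adjudication: C.-Q. Cheng, J. Xue, *Arnold
diffusion for nearly integrable Hamiltonian systems*, Sci. China Math. **66** (2023) no. 8, 1649–1712,
doi:10.1007/s11425-022-2118-1 (bib key `ChengXue2023`), read in the last arXiv text arXiv:1503.04153v5
(`n-diffusion05082019.tex`, locators `l.NNNN`), Appendix E, proof of Theorem `fundamental` (l.2895–2899) from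
Lemma `LmFundamental` (l.3086–3090; squares `𝕊_{d₁}(q*) = {|q − q*| ≤ d₁}`, l.3082; `Argmin(𝕊, B) = {q ∈ 𝕊 :
B(q) = min_𝕊 B}`, l.3084), covering step l.3095–3096 (verbatim): "A connected set V is said to be non-trivial
for 𝕊_{d₁}(q*) if π_iV∩𝕊_{d₁}(q*)=π_i𝕊_{d₁}(q*) holds for i=1 or 2. Otherwise, it is said to be trivial for
𝕊_{d₁}(q*). To finish the proof of Theorem [fundamental], we split the annulus N_k equally into squares
{𝕊_j=|q-q_j|≤d₁/5}. By Lemma [LmFundamental], for each 𝕊_j, there exists an open-dense set 𝔒_{k,j} ⊂ 𝔅_ε, for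
each H_δ ∈ 𝔒_{k,j} it holds simultaneously for all c ∈ I_k∩Γ*_c that the set Argmin(𝕊_j,B^ℓ_{c,ε}) is trivial
for 𝕊_j. … the diameter of each connected component of the Mañé set is not larger than (4/5)d₁ if it keeps away
from the Aubry set."  The same step in the published lineage the appendix follows (l.2857, l.3163): C.-Q.
Cheng, *Dynamics around the double resonance*, Camb. J. Math. **5** (2017) 153–228, p. 205 l.30–42 ("Dividing
the torus 𝖳 into squares with the side length d … If for each of the squares and for i = 1, 3, one has Π_i
argmin(u⁻_{σ,l} − u⁺_{σ,u})|_D ⊊ [x_{i,0} − d, x_{i,0} + d], the diameter of each connected component of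
argmin(u⁻_{σ,l} − u⁺_{σ,u})|_𝖳 will not be larger than 2d") and C.-Q. Cheng, J. Yan, J. Differential Geom. **82**
(2009) 229–277, p. 273–274 ("non-trivial for R_d if Π_i(V ∩ R_d) = {x_i* − d ≤ x_i ≤ x_i* + d} for some
0 ≤ i ≤ n … there exists a sequence d_i → 0 and a countable set {u_ij} such that for each G₁ ∈ ∩ H(d_i, u_ij),
F_σ + G₁ ⊂ Z_c", i.e. the minimal set is totally disconnected).  THESE ARE CLAIMS UNDER ADJUDICATION by the
pub-arnold near-miss cell (LEMMAS §3.X AF6, items (E4)/(E4′); claim rows C42–C44): nothing in this file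
asserts or uses any statement of those papers as a fact, and nothing here is a statement about Hamiltonian
systems.  `TrivialSquares.lean` (same directory) kernel-certifies that the step AS PRINTED — test regions =
the squares of a finite family, hypothesis = what Lemma `LmFundamental` delivers on each square ((Z1) l.3110,
(Z2) l.3131: both projections of `Argmin(𝕊_j, ·)` are proper sub-intervals of the sides) — does not imply any
diameter bound (`squareCriterion_false`, `localArgminsTrivial_not_sufficient`).

WHAT IS PROVED HERE (elementary plane point-set topology; every declaration kernel-checked, tagged [folklore]).
The covering conclusion DOES follow once the test regions are the THIN BOXES of a grid and only the SHORT-SIDE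
half of "trivial" is asked for.  Fix a grid step `η > 0`; the vertical box `vBox η m m' = [mη,(m+1)η] ×
[m'η,(m'+5)η]` and the horizontal box `hBox η m m' = [m'η,(m'+5)η] × [mη,(m+1)η]` (`m m' : ℤ`) are `1 × 5`
unions of grid cells; with the manuscript's numbers (`𝕊_j` of radius `d₁/5`, so `η = 2d₁/5`) each box is a
column/row of five consecutive `𝕊_j`, lies in an axis-parallel square of radius `d₁ = 5η/2` (`vBox_subset_sq`,
the size of the squares `𝕊_{d₁}(q*)` to which Lemma `LmFundamental` applies), and `2η = (4/5)d₁` is exactly the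
bound asserted at l.3096.  All distances and diameters are in the sup metric of `ℝ × ℝ` (Mathlib's product
metric; the `|·|` of l.3082).
* `dist_lt_of_gridBoxes_on` (MAIN, local form): `M` compact, `U` any region; if for every vertical box
  `⊆ U` the first projection of `M ∩ box` is NOT the whole short side and for every horizontal box `⊆ U` the
  second projection of `M ∩ box` is NOT the whole short side, then for every preconnected `V ⊆ M` and `p, q ∈ V`
  with `B̄(p, 3η) ⊆ U`: `dist p q < 2η`.  PROOF: otherwise boundary bumping (the tree's
  `Literature.Probability.Percolation.exists_subcontinuum_between_levels` with `φ = dist(·, p)`, packaged as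
  `exists_subcontinuum_closedBall`) gives a continuum `p ∈ K' ⊆ closure V ∩ B̄(p, 2η)` reaching the sphere of
  radius `2η`; the coordinate in which it reaches has projection `π_i K'` ⊇ an interval of length `2η`, which
  contains a whole grid interval `J` (`exists_gridIcc_subset`), while the other projection of `K'` fits in the
  five grid steps `J'` around `p` (`Icc_subset_gridIcc_five`); so `π_i (K' ∩ (J × J')) = J`
  (`exists_vBox_fst_image_eq` / `exists_hBox_snd_image_eq`, via `IsPreconnected.Icc_subset`), and the box
  `J × J'` lies in `B̄(p, 3η) ⊆ U` — contradiction.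
* `dist_lt_of_gridBoxes`, `diam_le_of_gridBoxes` (global form, `U = univ`): every preconnected `V ⊆ M` has
  `diam V ≤ 2η`; `diam_le_of_forall_not_nontrivialFor`: the same with the hypothesis phrased as "`M` is trivial
  (reading (R1), `¬ NontrivialFor M box` of `TrivialSquares.lean`) for every box of both orientations".
* `dist_lt_of_minOn_gridBoxes_on` (pointwise: only the depth of `p` in `U` is needed) /
  `diam_le_of_minOn_gridBoxes_on` / `diam_le_of_argmin_gridBoxes_on` (FUNCTION LEVEL, the format (Z1)/(Z2)
  would deliver FOR BOXES): for any `B : ℝ × ℝ → ℝ`, if on every vertical box `⊆ U` the first projection of the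
  local `Argmin(box, B)` is not the whole short side and on every horizontal box `⊆ U` the second projection of
  `Argmin(box, B)` is not the whole short side, then every compact preconnected set `K` of points minimising `B`
  over a domain `D ⊇ U` (resp. globally) with `B̄(K, 3η) ⊆ U` has `diam K ≤ 2η` (`D`-minimisers in a box `⊆ U`
  are local minimisers of the box).  Contrast `localArgminsTrivial_not_sufficient`.
* `isTotallyDisconnected_of_gridBoxes`: if `M` passes the box test at arbitrarily small steps, `M` is totally
  disconnected (the format of [CY2] p. 274, with the countable family "all `1 × 5` boxes of the `η_n`-grids").
CONSEQUENCE recorded by the cell (typed, NOT adjudicated; owners C16/C17/C43): the topological half of the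
cell's repair of AF6 (E4) is a theorem; what remains open for the auditor is analytic and internal to the
manuscript — whether the PROOF of Lemma `LmFundamental` (l.3101–3134) yields, for a BOX `J × J' ⊂ 𝕊_{d₁}(q*) ⊂
N_k` in place of the square, generic properness of the SHORT-side projection of `Argmin(J × J', B^ℓ_{c,δ})`
simultaneously in `c` (typed residual T-LmF-box in LEMMAS §3.X AF6 (E4′)).  That residual is the manuscript's
to carry and is NOT asserted here.
-/

open Set Metric

namespace Literature.Dynamics.Hamiltonian.ChengXue2023

/-- The VERTICAL grid box of the `η`-grid with indices `(m, m')`: one grid step wide, five grid steps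
tall, `[mη, (m+1)η] × [m'η, (m'+5)η]`. [folklore] -/
def vBox (η : ℝ) (m m' : ℤ) : Set (ℝ × ℝ) :=
  Icc ((m : ℝ) * η) (((m : ℝ) + 1) * η) ×ˢ Icc ((m' : ℝ) * η) (((m' : ℝ) + 5) * η)

/-- The HORIZONTAL grid box of the `η`-grid with indices `(m, m')`: five grid steps wide, one grid step
tall, `[m'η, (m'+5)η] × [mη, (m+1)η]`. [folklore] -/
def hBox (η : ℝ) (m m' : ℤ) : Set (ℝ × ℝ) :=
  Icc ((m' : ℝ) * η) (((m' : ℝ) + 5) * η) ×ˢ Icc ((m : ℝ) * η) (((m : ℝ) + 1) * η)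

/-- The short side of a vertical box is its first projection. [folklore] -/
theorem fst_image_vBox {η : ℝ} (hη : 0 < η) (m m' : ℤ) :
    Prod.fst '' vBox η m m' = Icc ((m : ℝ) * η) (((m : ℝ) + 1) * η) := by
  unfold vBox
  exact fst_image_prod _ (nonempty_Icc.2 (by nlinarith))

/-- The short side of a horizontal box is its second projection. [folklore] -/
theorem snd_image_hBox {η : ℝ} (hη : 0 < η) (m m' : ℤ) :
    Prod.snd '' hBox η m m' = Icc ((m : ℝ) * η) (((m : ℝ) + 1) * η) := by
  unfold hBox
  exact snd_image_prod (nonempty_Icc.2 (by nlinarith)) _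

/-- With the manuscript's grid step `η = 2d₁/5` a vertical `1 × 5` box lies in the axis-parallel square of
radius `d₁ = 5η/2` (`sq` of `TrivialSquares.lean`, the `𝕊_{d₁}` of l.3082) with the same centre. [folklore] -/
theorem vBox_subset_sq {η : ℝ} (hη : 0 < η) (m m' : ℤ) :
    vBox η m m' ⊆ sq (((m : ℝ) + 1 / 2) * η, ((m' : ℝ) + 5 / 2) * η) (5 * η / 2) := by
  rintro z ⟨⟨h1, h2⟩, ⟨h3, h4⟩⟩
  refine ⟨abs_le.mpr ⟨?_, ?_⟩, abs_le.mpr ⟨?_, ?_⟩⟩ <;> dsimp only <;> nlinarith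

/-- Same for horizontal boxes. [folklore] -/
theorem hBox_subset_sq {η : ℝ} (hη : 0 < η) (m m' : ℤ) :
    hBox η m m' ⊆ sq (((m' : ℝ) + 5 / 2) * η, ((m : ℝ) + 1 / 2) * η) (5 * η / 2) := by
  rintro z ⟨⟨h1, h2⟩, ⟨h3, h4⟩⟩
  refine ⟨abs_le.mpr ⟨?_, ?_⟩, abs_le.mpr ⟨?_, ?_⟩⟩ <;> dsimp only <;> nlinarith

/-- An interval of length `2η` starting at `lo` contains a whole closed grid interval `[mη, (m+1)η]`
(`m = ⌈lo/η⌉`). [folklore] -/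
theorem exists_gridIcc_subset {η : ℝ} (hη : 0 < η) (lo : ℝ) :
    ∃ m : ℤ, lo ≤ (m : ℝ) * η ∧ ((m : ℝ) + 1) * η ≤ lo + 2 * η := by
  refine ⟨⌈lo / η⌉, ?_, ?_⟩
  · have h := Int.le_ceil (lo / η)
    rwa [div_le_iff₀ hη] at h
  · have h := Int.ceil_lt_add_one (lo / η)
    have h' : (⌈lo / η⌉ : ℝ) * η < (lo / η + 1) * η := mul_lt_mul_of_pos_right h hη
    rw [add_mul, div_mul_cancel₀ lo hη.ne'] at h'
    linarith

/-- The closed `2η`-interval around `x` lies in the five-step grid interval starting at `(⌊x/η⌋ - 2)η`.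
[folklore] -/
theorem Icc_subset_gridIcc_five {η : ℝ} (hη : 0 < η) (x : ℝ) :
    Icc (x - 2 * η) (x + 2 * η) ⊆
      Icc (((⌊x / η⌋ - 2 : ℤ) : ℝ) * η) ((((⌊x / η⌋ - 2 : ℤ) : ℝ) + 5) * η) := by
  have h1 := Int.floor_le (x / η)
  have h2 := Int.lt_floor_add_one (x / η)
  have h1' : (⌊x / η⌋ : ℝ) * η ≤ x / η * η := mul_le_mul_of_nonneg_right h1 hη.le
  have h2' : x / η * η < ((⌊x / η⌋ : ℝ) + 1) * η := mul_lt_mul_of_pos_right h2 hη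
  rw [div_mul_cancel₀ x hη.ne'] at h1' h2'
  intro y hy
  obtain ⟨hy1, hy2⟩ := hy
  push_cast
  constructor <;> nlinarith

/-- … and that five-step grid interval lies in the closed `3η`-interval around `x`. [folklore] -/
theorem gridIcc_five_subset_Icc {η : ℝ} (hη : 0 < η) (x : ℝ) :
    Icc (((⌊x / η⌋ - 2 : ℤ) : ℝ) * η) ((((⌊x / η⌋ - 2 : ℤ) : ℝ) + 5) * η) ⊆
      Icc (x - 3 * η) (x + 3 * η) := by
  have h1 := Int.floor_le (x / η)
  have h2 := Int.lt_floor_add_one (x / η)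
  have h1' : (⌊x / η⌋ : ℝ) * η ≤ x / η * η := mul_le_mul_of_nonneg_right h1 hη.le
  have h2' : x / η * η < ((⌊x / η⌋ : ℝ) + 1) * η := mul_lt_mul_of_pos_right h2 hη
  rw [div_mul_cancel₀ x hη.ne'] at h1' h2'
  intro y hy
  obtain ⟨hy1, hy2⟩ := hy
  push_cast at hy1 hy2
  constructor <;> nlinarith

/-- ONE DIRECTION OF THE KEY STEP.  If a preconnected `K` lies in the closed sup-ball of radius `2η`
about `p` and contains two points whose FIRST coordinates differ by at least `2η`, then for some vertical
grid box contained in the closed sup-ball `B̄(p, 3η)` the first projection of `K ∩ box` is the whole short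
side: `K` is non-trivial (reading (R1), through `K ∩ box`) for that box. [folklore] -/
theorem exists_vBox_fst_image_eq {η : ℝ} (hη : 0 < η) {K : Set (ℝ × ℝ)} (hK : IsPreconnected K)
    {p a b : ℝ × ℝ} (hball : ∀ z ∈ K, dist z p ≤ 2 * η) (ha : a ∈ K) (hb : b ∈ K)
    (hab : a.1 + 2 * η ≤ b.1) :
    ∃ m m' : ℤ, vBox η m m' ⊆ closedBall p (3 * η) ∧
      Prod.fst '' (K ∩ vBox η m m') = Icc ((m : ℝ) * η) (((m : ℝ) + 1) * η) := by
  obtain ⟨m, hm1, hm2⟩ := exists_gridIcc_subset hη a.1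
  have hap := hball a ha
  have hbp := hball b hb
  rw [Prod.dist_eq, max_le_iff, Real.dist_eq, Real.dist_eq] at hap hbp
  obtain ⟨ha1, -⟩ := abs_le.mp hap.1
  obtain ⟨-, hb1⟩ := abs_le.mp hbp.1
  refine ⟨m, ⌊p.2 / η⌋ - 2, ?_, Subset.antisymm ?_ ?_⟩
  · rintro z ⟨hz1, hz2⟩
    have hz2' := gridIcc_five_subset_Icc hη p.2 hz2
    rw [mem_closedBall, Prod.dist_eq, max_le_iff, Real.dist_eq, Real.dist_eq, abs_le, abs_le]
    exact ⟨⟨by linarith [hz1.1], by linarith [hz1.2]⟩, ⟨by linarith [hz2'.1], by linarith [hz2'.2]⟩⟩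
  · rintro x ⟨z, ⟨-, hz⟩, rfl⟩
    exact hz.1
  · intro x hx
    -- `x` lies between the abscissae of `a` and `b`, hence is the abscissa of a point of `K`
    have hxab : x ∈ Icc a.1 b.1 := ⟨hm1.trans hx.1, hx.2.trans (hm2.trans hab)⟩
    have hproj : IsPreconnected (Prod.fst '' K) := hK.image _ continuous_fst.continuousOn
    obtain ⟨z, hzK, hzx⟩ := hproj.Icc_subset (mem_image_of_mem _ ha) (mem_image_of_mem _ hb) hxab
    refine ⟨z, ⟨hzK, ?_, ?_⟩, hzx⟩
    · rw [hzx]; exact hx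
    · have hz := hball z hzK
      rw [Prod.dist_eq, max_le_iff, Real.dist_eq, Real.dist_eq] at hz
      obtain ⟨hlo, hhi⟩ := abs_le.mp hz.2
      exact Icc_subset_gridIcc_five hη p.2 ⟨by linarith, by linarith⟩

/-- The same step in the second coordinate, with horizontal boxes. [folklore] -/
theorem exists_hBox_snd_image_eq {η : ℝ} (hη : 0 < η) {K : Set (ℝ × ℝ)} (hK : IsPreconnected K)
    {p a b : ℝ × ℝ} (hball : ∀ z ∈ K, dist z p ≤ 2 * η) (ha : a ∈ K) (hb : b ∈ K)
    (hab : a.2 + 2 * η ≤ b.2) :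
    ∃ m m' : ℤ, hBox η m m' ⊆ closedBall p (3 * η) ∧
      Prod.snd '' (K ∩ hBox η m m') = Icc ((m : ℝ) * η) (((m : ℝ) + 1) * η) := by
  obtain ⟨m, hm1, hm2⟩ := exists_gridIcc_subset hη a.2
  have hap := hball a ha
  have hbp := hball b hb
  rw [Prod.dist_eq, max_le_iff, Real.dist_eq, Real.dist_eq] at hap hbp
  obtain ⟨ha2, -⟩ := abs_le.mp hap.2
  obtain ⟨-, hb2⟩ := abs_le.mp hbp.2
  refine ⟨m, ⌊p.1 / η⌋ - 2, ?_, Subset.antisymm ?_ ?_⟩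
  · rintro z ⟨hz1, hz2⟩
    have hz1' := gridIcc_five_subset_Icc hη p.1 hz1
    rw [mem_closedBall, Prod.dist_eq, max_le_iff, Real.dist_eq, Real.dist_eq, abs_le, abs_le]
    exact ⟨⟨by linarith [hz1'.1], by linarith [hz1'.2]⟩, ⟨by linarith [hz2.1], by linarith [hz2.2]⟩⟩
  · rintro x ⟨z, ⟨-, hz⟩, rfl⟩
    exact hz.2
  · intro x hx
    have hxab : x ∈ Icc a.2 b.2 := ⟨hm1.trans hx.1, hx.2.trans (hm2.trans hab)⟩
    have hproj : IsPreconnected (Prod.snd '' K) := hK.image _ continuous_snd.continuousOn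
    obtain ⟨z, hzK, hzx⟩ := hproj.Icc_subset (mem_image_of_mem _ ha) (mem_image_of_mem _ hb) hxab
    refine ⟨z, ⟨hzK, ?_, ?_⟩, hzx⟩
    · have hz := hball z hzK
      rw [Prod.dist_eq, max_le_iff, Real.dist_eq, Real.dist_eq] at hz
      obtain ⟨hlo, hhi⟩ := abs_le.mp hz.1
      exact Icc_subset_gridIcc_five hη p.1 ⟨by linarith, by linarith⟩
    · rw [hzx]; exact hx

/-- **Boundary bumping, metric form** (from the tree's sub-continuum lemma
`Literature.Probability.Percolation.exists_subcontinuum_between_levels` with `φ = dist(·, p)`): a compact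
preconnected `K` containing `p` and a point at distance `≥ R` (`R ≥ 0`) from `p` contains a compact
preconnected `K' ∋ p` inside the closed ball `B̄(p, R)` reaching the sphere `{dist(·, p) = R}`. [folklore] -/
theorem exists_subcontinuum_closedBall {X : Type*} [MetricSpace X] {K : Set X} (hK : IsCompact K)
    (hKc : IsPreconnected K) {p q : X} (hp : p ∈ K) (hq : q ∈ K) {R : ℝ} (hR : 0 ≤ R)
    (hpq : R ≤ dist q p) :
    ∃ K' ⊆ K, IsCompact K' ∧ IsPreconnected K' ∧ p ∈ K' ∧ (∀ z ∈ K', dist z p ≤ R) ∧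
      ∃ u ∈ K', dist u p = R := by
  obtain ⟨K', hK'K, hK'c, hK'conn, hK'lev, ⟨z₀, hz₀, hz₀d⟩, ⟨u, hu, hud⟩⟩ :=
    Literature.Probability.Percolation.exists_subcontinuum_between_levels
      (continuous_id.dist continuous_const) hR hK hKc ⟨p, hp, (dist_self p).le⟩ ⟨q, hq, hpq⟩
  have hz₀p : z₀ = p := dist_eq_zero.1 hz₀d
  exact ⟨K', hK'K, hK'c, hK'conn, hz₀p ▸ hz₀, fun z hz => (hK'lev z hz).2, u, hu, hud⟩

/-- **MAIN THEOREM (the repaired covering criterion, local form, set level).**  Let `M ⊆ ℝ × ℝ` be compact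
(the set of minimal points), `η > 0` the grid step and `U` a region.  Suppose that for every vertical grid box
contained in `U` the first projection of `M ∩ box` is not the whole short side, and for every horizontal grid
box contained in `U` the second projection of `M ∩ box` is not the whole short side.  Then for every
preconnected `V ⊆ M` and `p, q ∈ V` with `B̄(p, 3η) ⊆ U` (sup metric): `dist p q < 2η`. [folklore] -/
theorem dist_lt_of_gridBoxes_on {η : ℝ} (hη : 0 < η) {M U : Set (ℝ × ℝ)} (hM : IsCompact M)
    (hv : ∀ m m' : ℤ, vBox η m m' ⊆ U →
      Prod.fst '' (M ∩ vBox η m m') ≠ Icc ((m : ℝ) * η) (((m : ℝ) + 1) * η))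
    (hh : ∀ m m' : ℤ, hBox η m m' ⊆ U →
      Prod.snd '' (M ∩ hBox η m m') ≠ Icc ((m : ℝ) * η) (((m : ℝ) + 1) * η))
    {V : Set (ℝ × ℝ)} (hVM : V ⊆ M) (hV : IsPreconnected V) {p q : ℝ × ℝ} (hp : p ∈ V)
    (hq : q ∈ V) (hpU : closedBall p (3 * η) ⊆ U) : dist p q < 2 * η := by
  by_contra hnot
  have hle : 2 * η ≤ dist q p := by rw [dist_comm]; exact not_lt.1 hnot
  -- the continuum `W = closure V ⊆ M`
  have hWM : closure V ⊆ M := closure_minimal hVM hM.isClosed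
  have hWc : IsCompact (closure V) := hM.of_isClosed_subset isClosed_closure hWM
  -- boundary bumping inside `W`
  obtain ⟨K', hK'W, -, hK'conn, hpK', hball, u, hu, hud⟩ :=
    exists_subcontinuum_closedBall hWc hV.closure (subset_closure hp) (subset_closure hq)
      (by positivity : (0 : ℝ) ≤ 2 * η) hle
  have hK'M : K' ⊆ M := hK'W.trans hWM
  -- some coordinate of `u - p` has absolute value `2η`
  have hcoord : 2 * η ≤ dist u.1 p.1 ∨ 2 * η ≤ dist u.2 p.2 := by
    rw [← le_max_iff, ← Prod.dist_eq]; exact hud.ge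
  rcases hcoord with h1 | h2
  · rw [Real.dist_eq] at h1
    -- order the two abscissae
    obtain ⟨a, b, ha, hb, hab⟩ : ∃ a b : ℝ × ℝ, a ∈ K' ∧ b ∈ K' ∧ a.1 + 2 * η ≤ b.1 := by
      rcases le_abs.mp h1 with h | h
      · exact ⟨p, u, hpK', hu, by linarith⟩
      · exact ⟨u, p, hu, hpK', by linarith⟩
    obtain ⟨m, m', hbox, hmm⟩ := exists_vBox_fst_image_eq hη hK'conn hball ha hb hab
    refine hv m m' (hbox.trans hpU) (Subset.antisymm ?_ ?_)
    · rintro x ⟨z, ⟨-, hz⟩, rfl⟩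
      exact hz.1
    · rw [← hmm]
      exact image_mono (inter_subset_inter_left _ hK'M)
  · rw [Real.dist_eq] at h2
    obtain ⟨a, b, ha, hb, hab⟩ : ∃ a b : ℝ × ℝ, a ∈ K' ∧ b ∈ K' ∧ a.2 + 2 * η ≤ b.2 := by
      rcases le_abs.mp h2 with h | h
      · exact ⟨p, u, hpK', hu, by linarith⟩
      · exact ⟨u, p, hu, hpK', by linarith⟩
    obtain ⟨m, m', hbox, hmm⟩ := exists_hBox_snd_image_eq hη hK'conn hball ha hb hab
    refine hh m m' (hbox.trans hpU) (Subset.antisymm ?_ ?_)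
    · rintro x ⟨z, ⟨-, hz⟩, rfl⟩
      exact hz.2
    · rw [← hmm]
      exact image_mono (inter_subset_inter_left _ hK'M)

/-- Global form (`U = univ`): if the box test holds for ALL grid boxes, any two points of a preconnected
subset of `M` are at sup-distance `< 2η`. [folklore] -/
theorem dist_lt_of_gridBoxes {η : ℝ} (hη : 0 < η) {M : Set (ℝ × ℝ)} (hM : IsCompact M)
    (hv : ∀ m m' : ℤ, Prod.fst '' (M ∩ vBox η m m') ≠ Icc ((m : ℝ) * η) (((m : ℝ) + 1) * η))
    (hh : ∀ m m' : ℤ, Prod.snd '' (M ∩ hBox η m m') ≠ Icc ((m : ℝ) * η) (((m : ℝ) + 1) * η))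
    {V : Set (ℝ × ℝ)} (hVM : V ⊆ M) (hV : IsPreconnected V) {p q : ℝ × ℝ} (hp : p ∈ V)
    (hq : q ∈ V) : dist p q < 2 * η :=
  dist_lt_of_gridBoxes_on (U := univ) hη hM (fun m m' _ => hv m m') (fun m m' _ => hh m m') hVM hV hp
    hq (subset_univ _)

/-- Corollary: every preconnected subset of `M` has diameter `≤ 2η` (sup metric). [folklore] -/
theorem diam_le_of_gridBoxes {η : ℝ} (hη : 0 < η) {M : Set (ℝ × ℝ)} (hM : IsCompact M)
    (hv : ∀ m m' : ℤ, Prod.fst '' (M ∩ vBox η m m') ≠ Icc ((m : ℝ) * η) (((m : ℝ) + 1) * η))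
    (hh : ∀ m m' : ℤ, Prod.snd '' (M ∩ hBox η m m') ≠ Icc ((m : ℝ) * η) (((m : ℝ) + 1) * η))
    {V : Set (ℝ × ℝ)} (hVM : V ⊆ M) (hV : IsPreconnected V) : diam V ≤ 2 * η :=
  diam_le_of_forall_dist_le (by positivity) fun _ hp _ hq =>
    (dist_lt_of_gridBoxes hη hM hv hh hVM hV hp hq).le

/-- The criterion in the vocabulary of `TrivialSquares.lean`: if `M` is TRIVIAL (reading (R1),
`¬ NontrivialFor M box`) for every vertical and every horizontal `1 × 5` grid box, then every preconnected
subset of `M` has sup-diameter `≤ 2η` — the POSITIVE counterpart of `squareCriterion_false` (the squares of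
any finite family can all be crossed corner-wise by one diagonal segment; thin boxes of both orientations
cannot). Only the short-side half of "trivial" is used. [folklore] -/
theorem diam_le_of_forall_not_nontrivialFor {η : ℝ} (hη : 0 < η) {M : Set (ℝ × ℝ)}
    (hM : IsCompact M) (hv : ∀ m m' : ℤ, ¬ NontrivialFor M (vBox η m m'))
    (hh : ∀ m m' : ℤ, ¬ NontrivialFor M (hBox η m m')) {V : Set (ℝ × ℝ)} (hVM : V ⊆ M)
    (hV : IsPreconnected V) : diam V ≤ 2 * η := by
  refine diam_le_of_gridBoxes hη hM (fun m m' h => hv m m' (Or.inl ?_))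
    (fun m m' h => hh m m' (Or.inr ?_)) hVM hV
  · rw [h, fst_image_vBox hη]
  · rw [h, snd_image_hBox hη]

/-- **FUNCTION LEVEL, pointwise (the format of (Z1)/(Z2), l.3110/l.3131, but FOR BOXES; local form,
minimality relative to a domain `D ⊇ U`).**  Let `B : ℝ × ℝ → ℝ` be any function, `U ⊆ D` regions and `K` a
compact preconnected set of points minimising `B` OVER `D` (e.g. `D` = the annulus / section on which the barrier
function is minimised).  If on every vertical grid box `⊆ U` the first projection of the local `Argmin(box, B)` is
not the whole short side, and on every horizontal grid box `⊆ U` the second projection of `Argmin(box, B)` is not the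
whole short side, then every `q ∈ K` is at sup-distance `< 2η` from any `p ∈ K` whose closed sup-ball `B̄(p, 3η)`
lies in `U` (only the depth of `p` in `U` is needed).  (`D`-minimisers lying in a box `⊆ U ⊆ D` are local
minimisers of that box, so a full short-side projection of `K' ∩ box` forces one of `Argmin(box, B)`.) [folklore] -/
theorem dist_lt_of_minOn_gridBoxes_on {η : ℝ} (hη : 0 < η) {B : ℝ × ℝ → ℝ} {K U D : Set (ℝ × ℝ)}
    (hK : IsCompact K) (hKc : IsPreconnected K) (hKmin : ∀ q ∈ K, ∀ q' ∈ D, B q ≤ B q') (hUD : U ⊆ D)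
    (hv : ∀ m m' : ℤ, vBox η m m' ⊆ U →
      Prod.fst '' Argmin (vBox η m m') B ≠ Icc ((m : ℝ) * η) (((m : ℝ) + 1) * η))
    (hh : ∀ m m' : ℤ, hBox η m m' ⊆ U →
      Prod.snd '' Argmin (hBox η m m') B ≠ Icc ((m : ℝ) * η) (((m : ℝ) + 1) * η))
    {p q : ℝ × ℝ} (hp : p ∈ K) (hq : q ∈ K) (hpU : closedBall p (3 * η) ⊆ U) : dist p q < 2 * η := by
  have hsub : ∀ S ⊆ U, K ∩ S ⊆ Argmin S B :=
    fun S hS z hz => ⟨hz.2, fun q' hq' => hKmin z hz.1 q' (hUD (hS hq'))⟩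
  refine dist_lt_of_gridBoxes_on hη hK (fun m m' hU h => hv m m' hU (Subset.antisymm ?_ ?_))
    (fun m m' hU h => hh m m' hU (Subset.antisymm ?_ ?_)) subset_rfl hKc hp hq hpU
  · rintro x ⟨z, ⟨hz, -⟩, rfl⟩
    exact hz.1
  · rw [← h]; exact image_mono (hsub _ hU)
  · rintro x ⟨z, ⟨hz, -⟩, rfl⟩
    exact hz.2
  · rw [← h]; exact image_mono (hsub _ hU)

/-- **FUNCTION LEVEL, diameter form** of `dist_lt_of_minOn_gridBoxes_on`: if moreover `B̄(z, 3η) ⊆ U` for ALL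
`z ∈ K`, then `K` has sup-diameter `≤ 2η`.  Contrast `localArgminsTrivial_not_sufficient` (squares). [folklore] -/
theorem diam_le_of_minOn_gridBoxes_on {η : ℝ} (hη : 0 < η) {B : ℝ × ℝ → ℝ} {K U D : Set (ℝ × ℝ)}
    (hK : IsCompact K) (hKc : IsPreconnected K) (hKmin : ∀ q ∈ K, ∀ q' ∈ D, B q ≤ B q') (hUD : U ⊆ D)
    (hKU : ∀ z ∈ K, closedBall z (3 * η) ⊆ U)
    (hv : ∀ m m' : ℤ, vBox η m m' ⊆ U →
      Prod.fst '' Argmin (vBox η m m') B ≠ Icc ((m : ℝ) * η) (((m : ℝ) + 1) * η))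
    (hh : ∀ m m' : ℤ, hBox η m m' ⊆ U →
      Prod.snd '' Argmin (hBox η m m') B ≠ Icc ((m : ℝ) * η) (((m : ℝ) + 1) * η)) :
    diam K ≤ 2 * η :=
  diam_le_of_forall_dist_le (by positivity) fun p hp q hq =>
    (dist_lt_of_minOn_gridBoxes_on hη hK hKc hKmin hUD hv hh hp hq (hKU p hp)).le

/-- **FUNCTION LEVEL, global minimisers** (`D = univ` in `diam_le_of_minOn_gridBoxes_on`).  Let
`B : ℝ × ℝ → ℝ` be any function, `U` a region and `K` a compact preconnected set of GLOBAL minimum points of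
`B` with `B̄(z, 3η) ⊆ U` for all `z ∈ K`.  If on every vertical grid box `⊆ U` the first projection of the local
`Argmin(box, B)` is not the whole short side, and on every horizontal grid box `⊆ U` the second projection of
`Argmin(box, B)` is not the whole short side, then `K` has sup-diameter `≤ 2η`.  Contrast
`localArgminsTrivial_not_sufficient` (squares).  `U = univ` gives the fully global form. [folklore] -/
theorem diam_le_of_argmin_gridBoxes_on {η : ℝ} (hη : 0 < η) {B : ℝ × ℝ → ℝ} {K U : Set (ℝ × ℝ)}
    (hK : IsCompact K) (hKc : IsPreconnected K) (hKmin : ∀ q ∈ K, ∀ q' : ℝ × ℝ, B q ≤ B q')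
    (hKU : ∀ z ∈ K, closedBall z (3 * η) ⊆ U)
    (hv : ∀ m m' : ℤ, vBox η m m' ⊆ U →
      Prod.fst '' Argmin (vBox η m m') B ≠ Icc ((m : ℝ) * η) (((m : ℝ) + 1) * η))
    (hh : ∀ m m' : ℤ, hBox η m m' ⊆ U →
      Prod.snd '' Argmin (hBox η m m') B ≠ Icc ((m : ℝ) * η) (((m : ℝ) + 1) * η)) :
    diam K ≤ 2 * η :=
  diam_le_of_minOn_gridBoxes_on (D := univ) hη hK hKc (fun q hq q' _ => hKmin q hq q') (subset_univ U) hKU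
    hv hh

/-- **All scales: totally disconnected** (the format of [CY2] p. 274, "M is totally disconnected", with
the countable family of all `1 × 5` boxes of grids of arbitrarily small step).  If for arbitrarily small `η > 0`
the compact set `M` passes the grid-box test at step `η`, then `M` is totally disconnected. [folklore] -/
theorem isTotallyDisconnected_of_gridBoxes {M : Set (ℝ × ℝ)} (hM : IsCompact M)
    (h : ∀ ε > 0, ∃ η, 0 < η ∧ η ≤ ε ∧
      (∀ m m' : ℤ, Prod.fst '' (M ∩ vBox η m m') ≠ Icc ((m : ℝ) * η) (((m : ℝ) + 1) * η)) ∧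
      (∀ m m' : ℤ, Prod.snd '' (M ∩ hBox η m m') ≠ Icc ((m : ℝ) * η) (((m : ℝ) + 1) * η))) :
    IsTotallyDisconnected M := by
  intro V hVM hV p hp q hq
  by_contra hpq
  have hd : 0 < dist p q := dist_pos.2 hpq
  obtain ⟨η, hη, hηε, hv, hh⟩ := h (dist p q / 4) (by positivity)
  have := dist_lt_of_gridBoxes hη hM hv hh hVM hV hp hq
  linarith

end Literature.Dynamics.Hamiltonian.ChengXue2023
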